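import Literature.NumberTheory.LocalFields.QuadraticLocalNormDichotomy                 -- ★ `IsCMField.exists_fixed_nonnorm_dichotomy'` (σ_w-currency, EVERY non-split place)
import Literature.NumberTheory.Automorphic.AnisotropicUnitaryGroupCompactOfPlace      -- ★ `conjLocal_apply_eq_of_smul_eq` (`(c ⊗ 1) y` at `w` is `σ_w (y_w)`)
import Literature.NumberTheory.Automorphic.UnitaryGroupNonsplitPlace                  -- ★ `PlacesOver.eq_of_smul_eq`
import Literature.NumberTheory.Automorphic.UnitaryGroupSplitPlace                     -- ★ `PlacesOver.eq_or_eq_galInv`, `galInv_ne`, `galInv_galInv`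
import Literature.NumberTheory.Automorphic.QuadraticLocalBaseChange                   -- ★ instance `PlacesOver.nonempty`
import HarnessLib

/-!
# R90-TF · S4 (Ch. 13.1–2) · hand p04 — (F2b) the `(c ⊗ 1)`-FIXED UNITS of `L ⊗ L⁺_v = Π_{w ∣ v} L_w` fall into AT MOST TWO classes modulo
# the NORMS `z̄ · z` of units, at EVERY finite place `v` of `L⁺` (non-split: the local norm dichotomy; split: every fixed unit is a norm)

Cell `hodgecm-mathlib`, crux H413 (`stmt-HodgeConjecture-24833`), route of record `HCCMUnconditional`; programme R90-TF (brief
`director/R90-BRIEF.v2.md` 1f40d54518340a35), section S4 = Rogawski Ch. 13.1–2 (base `R90-C131`), seat R90-C131-p04 (g0), socket S4#B3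
`R90.S4.stub_R90_S4_H_cover` (`Cruxes/H413/Lines/R90_S4_HPacketsU2B.lean` :338) ROAD «SCHUR ⊠-SPLITTING + FINITE ORBIT», step (F2b) (= the «multiplier
classes `≤ #(F_v^×/N E_w^×) ≤ 2`» census input of S4#B4 `_card`, hand p03, now a THEOREM).  Lane `--supports stmt-HodgeConjecture-24833 --as helper`;
ONE public theorem, no definition, no instance, no notation, no `sorry`.

THE MATHEMATICS ([Rogawski1990, Prop. 11.1.1 (a) p. 161: the similitude group acts on `E(U(2))` through `F^×/N E^×`]; [Serre1979, Ch. XIV §3]; [NeukirchANT1999,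
Ch. V (1.1)]).  Write `A = L ⊗_{L⁺} L⁺_v = Π_{w ∣ v} L_w` (★ `UnitaryGroup.LocalRing L v`) with its conjugation `σ = c ⊗ 1` (★ `conjLocal`).
* NON-SPLIT `v` (one place `w ∣ v`, `c • w = w`; ★ `PlacesOver.eq_of_smul_eq`): `A = L_w`, `σ = σ_w` (★ `conjLocal_apply_eq_of_smul_eq`), and the local norm
  dichotomy ★ `IsCMField.exists_fixed_nonnorm_dichotomy'` (LCFT-free Herbrand road, EVERY residue characteristic): there is a `σ_w`-fixed `ε ≠ 0` such that every
  `σ_w`-fixed `s ≠ 0` is `z σ_w z` or `ε · z σ_w z` with `z ≠ 0`.  Representatives `{1, ε}`.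
* SPLIT `v` (two places `w₀ ≠ c⁻¹ • w₀`; ★ `PlacesOver.eq_or_eq_galInv`, `galInv_ne`): `σ` SWAPS the two factors (`(σ x)_w = σ_*(x_{c⁻¹ w})`, ★ `conjLocal_apply`), so a
  fixed unit `a = (a₀, σ_* a₀)` is the norm of `z = (a₀, 1)`: `σ z · z = (σ_* 1 · a₀, σ_* a₀ · 1) = a`.  Representative `{1}`.
Hence: a finite set `R ⊆ A` of fixed units, `#R ≤ 2`, with every fixed unit `a` of the form `σ z · z · r`, `r ∈ R`, `z ∈ A^×`.  (The exact count
`[F_v^× : N] = 2` at non-split `v` — ★ `IsCMField.index_range_norm_place_eq_two` — is not needed here.)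

HONEST LABEL: HC_CM is proved only modulo the 7 printed citations (2 remaining named inputs: hLiu418 = stmt-HodgeConjecture-24832, h413 =
stmt-HodgeConjecture-24833) until rung 0 closes; this file is unconditional local algebra and discharges none of them.  REL ≠ ★ ≠ BUILT.

## References
* [Rogawski1990] J. D. Rogawski, *Automorphic Representations of Unitary Groups in Three Variables*, Ann. of Math. Stud. 123 (1990), Prop. 11.1.1 (a) p. 161.
* [Serre1979] J.-P. Serre, *Local Fields*, GTM 67 (1979), Ch. XIV §3.
* [NeukirchANT1999] J. Neukirch, *Algebraic Number Theory* (1999), Ch. V §1 Thm. (1.1).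
* [CasselsFrohlichANT1967] J. W. S. Cassels, A. Fröhlich (eds.), *Algebraic Number Theory* (1967), Ch. VII Prop. 1.2 (ii), §1.1.
-/

set_option autoImplicit false
set_option linter.dupNamespace false

noncomputable section

open NumberField IsDedekindDomain
open Literature.NumberTheory.Automorphic Literature.NumberTheory.Automorphic.UnitaryGroup

namespace Summit.HodgeConjecture.HodgeConjecture.R90.S4

variable (L : Type) [Field L] [NumberField L] [IsCMField L] (v : HeightOneSpectrum (𝓞 ↥(maximalRealSubfield L)))

/-- **(F2b) The conjugation-fixed units of `L ⊗ L⁺_v` modulo the norms `z̄ · z` (`z` a unit) have AT MOST TWO classes, at EVERY finite place `v`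
of `L⁺`**: there is a finite set `R` of fixed units, `#R ≤ 2`, such that every fixed unit `a` is `z̄ · z · r` for some `r ∈ R` and some unit `z`.
Non-split `v`: `R = {1, ε}` from the local norm dichotomy ★ `IsCMField.exists_fixed_nonnorm_dichotomy'` through the one-place reading ★
`conjLocal_apply_eq_of_smul_eq`; split `v`: `R = {1}`, `(a₀, σ_* a₀) = σ(a₀, 1) · (a₀, 1)`.
[cite: Rogawski1990, Prop. 11.1.1 (a) p. 161] [cite: Serre1979, Ch. XIV §3] [cite: NeukirchANT1999, Ch. V §1 Thm. (1.1)] -/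
theorem exists_fixed_units_mod_norms_card_le_two :
    ∃ R : Finset (LocalRing L v), R.card ≤ 2 ∧
      (∀ r ∈ R, IsUnit r ∧ conjLocal L (IsCMField.complexConj L) v r = r) ∧
      ∀ a : LocalRing L v, IsUnit a → conjLocal L (IsCMField.complexConj L) v a = a →
        ∃ r ∈ R, ∃ z : (LocalRing L v)ˣ, a = conjLocal L (IsCMField.complexConj L) v z * z * r := by
  classical
  haveI : Algebra.IsQuadraticExtension ↥(maximalRealSubfield L) L := IsCMField.isQuadraticExtension L
  have hc : IsCMField.complexConj L ≠ 1 := IsCMField.complexConj_ne_one L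
  by_cases hns : ∃ w : PlacesOver L v, IsCMField.complexConj L • w.1 = w.1
  · /- NON-SPLIT: one place `w`, `σ = σ_w` at `w`, representatives `{1, ε}` -/
    obtain ⟨w, hw⟩ := hns
    have hσw : ∀ y : LocalRing L v, conjLocal L (IsCMField.complexConj L) v y w =
        galAdicCompletionMap (L := L) (IsCMField.complexConj L) hw (y w) :=
      conjLocal_apply_eq_of_smul_eq (IsCMField.complexConj L) hc v w hw
    have heq : ∀ w' : PlacesOver L v, w' = w := PlacesOver.eq_of_smul_eq (IsCMField.complexConj L) hc w hw
    -- the local norm dichotomy at `w`, read in this file's spelling of `L_w` and `σ_w` (★ (J3′) for CM fields; `SemiLocal.Place L⁺ L v` IS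
    -- `PlacesOver L v`, and `Place.val w` unfolds to `w.1`)
    obtain ⟨ε, hεfix, hε0, -, hdich⟩ :
        ∃ ε : w.1.adicCompletion L, galAdicCompletionMap (L := L) (IsCMField.complexConj L) hw ε = ε ∧ ε ≠ 0 ∧
          (¬ ∃ t : w.1.adicCompletion L, t * galAdicCompletionMap (L := L) (IsCMField.complexConj L) hw t = ε) ∧
          ∀ s : w.1.adicCompletion L, s ≠ 0 → galAdicCompletionMap (L := L) (IsCMField.complexConj L) hw s = s →
            ∃ z : w.1.adicCompletion L, z ≠ 0 ∧
              (s = z * galAdicCompletionMap (L := L) (IsCMField.complexConj L) hw z ∨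
                s = ε * (z * galAdicCompletionMap (L := L) (IsCMField.complexConj L) hw z)) :=
      Literature.NumberTheory.LocalFields.IsCMField.exists_fixed_nonnorm_dichotomy' L w hw
    let εt : LocalRing L v := Function.update 1 w ε
    have hεt : εt w = ε := by simp only [εt, Function.update_self]
    refine ⟨{1, εt}, (Finset.card_insert_le _ _).trans (by rw [Finset.card_singleton]), ?_, ?_⟩
    · intro r hr
      rcases Finset.mem_insert.1 hr with rfl | hr
      · exact ⟨isUnit_one, map_one _⟩
      · rw [Finset.mem_singleton] at hr
        subst hr
        refine ⟨Pi.isUnit_iff.2 fun w' => ?_, funext fun w' => ?_⟩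
        · obtain rfl := heq w'
          rw [hεt]
          exact isUnit_iff_ne_zero.2 hε0
        · obtain rfl := heq w'
          rw [hσw, hεt, hεfix]
    · intro a ha hσa
      have ha0 : a w ≠ 0 := ((Pi.isUnit_iff.1 ha) w).ne_zero
      have haw : galAdicCompletionMap (L := L) (IsCMField.complexConj L) hw (a w) = a w := by
        rw [← hσw, hσa]
      obtain ⟨z₀, hz₀, hz⟩ := hdich (a w) ha0 haw
      let zt : LocalRing L v := Function.update 1 w z₀
      have hzt : zt w = z₀ := by simp only [zt, Function.update_self]
      have hztu : IsUnit zt := Pi.isUnit_iff.2 fun w' => by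
        obtain rfl := heq w'
        rw [hzt]
        exact isUnit_iff_ne_zero.2 hz₀
      rcases hz with hz | hz
      · refine ⟨1, Finset.mem_insert_self _ _, hztu.unit, funext fun w' => ?_⟩
        obtain rfl := heq w'
        rw [Pi.mul_apply, Pi.mul_apply, Pi.one_apply, mul_one, hσw, IsUnit.unit_spec, hzt, mul_comm]
        exact hz
      · refine ⟨εt, Finset.mem_insert_of_mem (Finset.mem_singleton_self _), hztu.unit, funext fun w' => ?_⟩
        obtain rfl := heq w'
        rw [Pi.mul_apply, Pi.mul_apply, hσw, IsUnit.unit_spec, hzt, hεt, hz]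
        ring
  · /- SPLIT: two places `w₀ ≠ c⁻¹ • w₀`, every fixed unit is a norm, representative `{1}` -/
    push Not at hns
    obtain ⟨w₀⟩ := (inferInstance : Nonempty (PlacesOver L v))
    refine ⟨{1}, by rw [Finset.card_singleton]; omega, fun r hr => ?_, fun a ha hσa => ?_⟩
    · rw [Finset.mem_singleton] at hr
      subst hr
      exact ⟨isUnit_one, map_one _⟩
    · have hne : PlacesOver.galInv (IsCMField.complexConj L) w₀ ≠ w₀ := PlacesOver.galInv_ne _ w₀ (hns w₀)
      let z : LocalRing L v := fun w' => if w' = w₀ then a w' else 1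
      have hzu : IsUnit z := Pi.isUnit_iff.2 fun w' => by
        by_cases h : w' = w₀
        · simp only [z, if_pos h]
          exact (Pi.isUnit_iff.1 ha) w'
        · simp only [z, if_neg h]
          exact isUnit_one
      refine ⟨1, Finset.mem_singleton_self _, hzu.unit, funext fun w' => ?_⟩
      rw [Pi.mul_apply, Pi.mul_apply, Pi.one_apply, mul_one, IsUnit.unit_spec, conjLocal_apply]
      rcases PlacesOver.eq_or_eq_galInv (IsCMField.complexConj L) hc w₀ w' with rfl | rfl
      · -- at `w₀`: `σ_*(z_{c⁻¹ w₀}) · z_{w₀} = σ_* 1 · a_{w₀}`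
        have h1 : z (PlacesOver.galInv (IsCMField.complexConj L) w') = 1 := if_neg hne
        have h2 : z w' = a w' := if_pos rfl
        change a w' = galAdicCompletionMap (L := L) (IsCMField.complexConj L) _ (z (PlacesOver.galInv (IsCMField.complexConj L) w')) * z w'
        rw [h1, map_one, one_mul, h2]
      · -- at `w₁ = c⁻¹ w₀`: `σ_*(z_{w₀}) · 1 = σ_*(a_{w₀}) = (σ a)_{w₁} = a_{w₁}`
        have h1 : z (PlacesOver.galInv (IsCMField.complexConj L) (PlacesOver.galInv (IsCMField.complexConj L) w₀)) =
            a (PlacesOver.galInv (IsCMField.complexConj L) (PlacesOver.galInv (IsCMField.complexConj L) w₀)) :=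
          if_pos (PlacesOver.galInv_galInv _ hc w₀)
        have h2 : z (PlacesOver.galInv (IsCMField.complexConj L) w₀) = 1 := if_neg hne
        change a (PlacesOver.galInv (IsCMField.complexConj L) w₀) = galAdicCompletionMap (L := L) (IsCMField.complexConj L) _
            (z (PlacesOver.galInv (IsCMField.complexConj L) (PlacesOver.galInv (IsCMField.complexConj L) w₀))) *
          z (PlacesOver.galInv (IsCMField.complexConj L) w₀)
        rw [h1, h2, mul_one]
        have h3 := congr_fun hσa (PlacesOver.galInv (IsCMField.complexConj L) w₀)
        rw [conjLocal_apply] at h3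
        exact h3.symm

end Summit.HodgeConjecture.HodgeConjecture.R90.S4

end
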